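import Mathlib.AlgebraicGeometry.Morphisms.Flat
import Mathlib.AlgebraicGeometry.Morphisms.Affine
import Literature.AlgebraicGeometry.Motives.SubschemeCyclesProofs
import Literature.AlgebraicGeometry.Dimension.PointDimension
import Literature.RingTheory.KrullDimension.BaseChangeDimension
import HarnessLib

/-!
# Base change of cycles preserves the dimension grading: proof

Discharges the named fact `Literature.AlgebraicGeometry.Motives.AlgebraicCycle.baseChange_mem_cyclesOfDim` of
`Literature.AlgebraicGeometry.Motives.SubschemeCycles`: for a `k`-scheme `X` locally of finite
type, a homomorphism of fields `σ : k →+* L` and the (flat) projection `π : X_σ = X ×_{k,σ} Spec L ⟶ X`,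
the pull-back `π^* : Z_* X → Z_* X_σ` maps `d`-cycles to `d`-cycles
(Fulton, *Intersection Theory*, Example 6.2.9: "For a `k`-cycle `α = ∑ n_V [V]` on `X`, let `α_L`
be the `k`-cycle `∑ n_V [V_L]` on `X_L`", i.e. `V_L = V ×ₖ Spec L` is purely `dim V`-dimensional;
Görtz–Wedhorn I, Prop. 5.38 and Exercise 5.12; EGA IV₂ §4.2).

With the coefficient formula `(π^* c)(z) = c(π z) · ℓ(𝒪_{(X_σ)_{π z}, z})` (`Literature.AlgebraicGeometry.Motives.flatPullback_apply`),
the statement is: **if `z ∈ X_σ` lies over `x` and is a generic point of an irreducible component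
of its fibre `(X_σ)_x = Spec (κ(x) ⊗ₖ L)` (i.e. the local ring of the fibre at `z` has finite
length), then `dim closure {z} = dim closure {x}`**, `Order.height z = Order.height x` in the
specialisation orders (`Literature.AlgebraicGeometry.Motives.Scheme.height_eq_height_of_length_stalkFiber_ne_top`).

## Proof

In an affine chart `U = Spec R ∋ x` of `X` (`R` of finite type over `k`) and the affine chart
`U' = π⁻¹ U = Spec R'` of `X_σ`, Mathlib's `AlgebraicGeometry.isIso_pushoutSection_of_isAffineOpen`
identifies `R'` with the pushout `R ⊗ₖ L` (`Algebra.IsPushout k R L R'`). Let `𝔮 ⊂ R'`, `𝔭 ⊂ R`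
be the primes of `z`, `x`. By the chart formula for the dimension of a point
(`Literature.AlgebraicGeometry.Dimension.Scheme.height_eq_ringKrullDim_quotient_primeIdealOf`, Görtz–Wedhorn I, Thm. 5.22),
`height z = dim R' ⧸ 𝔮` and `height x = dim R ⧸ 𝔭`. The local ring of the fibre at `z` is
`𝒪_{X_σ,z} ⧸ 𝔪ₓ 𝒪_{X_σ,z}` (`Literature.AlgebraicGeometry.Motives.nonempty_stalkFiber_ringEquiv_asFiber`), i.e. `R'_𝔮 ⧸ 𝔭 R'_𝔮`
(Mathlib `IsAffineOpen.arrowStalkMapIso`); its finite length makes `𝔮` minimal over `𝔭R'`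
(`Literature.RingTheory.KrullDimension.mem_minimalPrimes_map_of_length_ne_top`), and then `dim R' ⧸ 𝔮 = dim R ⧸ 𝔭` is the
dimension of the components of the base change `(R ⧸ 𝔭) ⊗ₖ L` of the affine domain `R ⧸ 𝔭`
(`Literature.RingTheory.KrullDimension.ringKrullDim_quotient_eq_of_isPushout_of_mem_minimalPrimes`, Görtz–Wedhorn I, Prop. 5.38 /
Exercise 5.12).

## Main results

* `Literature.AlgebraicGeometry.Motives.Scheme.height_eq_height_of_length_stalkFiber_ne_top`: `height z = height (π z)` for `z`
  generic in its fibre, `π : X ×ₖ Spec L → X`, `X` locally of finite type over `k`.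
* `Literature.AlgebraicCycle.baseChange_mem_cyclesOfDim_holds : AlgebraicCycle.baseChange_mem_cyclesOfDim σ X`.

## References

* W. Fulton, *Intersection Theory*, 2nd ed. (1998), §1.7 and Example 6.2.9.
* U. Görtz, T. Wedhorn, *Algebraic Geometry I: Schemes*, 2nd ed. (2020), Thm. 5.22, Prop. 5.38,
  Cor. 5.45, Cor. 5.47, Exercise 5.12.
* A. Grothendieck, EGA IV₂ §4.2 (base change and dimension).
-/

universe u

open CategoryTheory AlgebraicGeometry Limits Order IsLocalRing

namespace Literature.AlgebraicGeometry.Motives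

/-! ### Heights of points under base change of the ground field -/

section HeightBaseChange

variable {k L : Type u} [Field k] [Field L] (σ : k →+* L) {X X' : Scheme.{u}}
  (p : X ⟶ Spec (CommRingCat.of k)) (π : X' ⟶ X) (p' : X' ⟶ Spec (CommRingCat.of L))

/-- The multiplicity `stalkLength Z z = ℓ(𝒪_{Z,z})` is non-zero only if `𝒪_{Z,z}` has finite length
(the junk value of `stalkLength` for infinite length is `0`). [folklore] -/
lemma length_ne_top_of_stalkLength_ne_zero {Z : Scheme.{u}} {z : Z} (h : stalkLength Z z ≠ 0) :
    Module.length (Z.presheaf.stalk z) (Z.presheaf.stalk z) ≠ ⊤ :=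
  fun h' ↦ h (by simp [stalkLength, h'])

/-- **Generic points of fibre components of `X_L → X` have the dimension of their image**
(Görtz–Wedhorn I, Exercise 5.12 with Cor. 5.45; Fulton, *Intersection Theory*, Example 6.2.9:
`V_L` is purely `dim V`-dimensional). Let `X` be locally of finite type over a field `k`,
`σ : k →+* L` a field homomorphism, `π : X' = X ×_{k,σ} Spec L → X` the projection of a cartesian
square over `Spec L → Spec k`, and `z` a point of `X'` whose local ring in its fibre `π⁻¹(π z)`
has finite length (i.e. `z` is a generic point of an irreducible component of the fibre). Then
`Order.height z = Order.height (π z)`: the closures of `z` and of `π z` have the same dimension.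
[cite: GortzWedhorn2020, Exercise 5.12] [cite: Fulton1998, Example 6.2.9] -/
theorem Scheme.height_eq_height_of_length_stalkFiber_ne_top
    (H : IsPullback π p' p (Spec.map (CommRingCat.ofHom σ))) [LocallyOfFiniteType p] (z : X')
    (hlen : Module.length ((π.fiber (π z)).presheaf.stalk (π.asFiber z))
      ((π.fiber (π z)).presheaf.stalk (π.asFiber z)) ≠ ⊤) :
    height z = height (π z) := by
  classical
  haveI : LocallyOfFiniteType p' :=
    MorphismProperty.of_isPullback (P := @LocallyOfFiniteType) H inferInstance
  haveI : IsAffineHom π := MorphismProperty.of_isPullback (P := @IsAffineHom) H.flip inferInstance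
  -- affine charts `U ∋ π z` and `U' = π⁻¹ U ∋ z`
  obtain ⟨_, ⟨U, hU, rfl⟩, hxU, -⟩ :=
    X.isBasis_affineOpens.exists_subset_of_mem_open (Set.mem_univ (π z)) isOpen_univ
  have hU' : IsAffineOpen (π ⁻¹ᵁ U) := hU.preimage π
  have hzU' : z ∈ π ⁻¹ᵁ U := hxU
  -- heights in the charts (Görtz–Wedhorn I, Thm. 5.22)
  have hz := Dimension.Scheme.height_eq_ringKrullDim_quotient_primeIdealOf p' hU' hzU'
  have hxh := Dimension.Scheme.height_eq_ringKrullDim_quotient_primeIdealOf p hU hxU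
  -- rings, primes and algebra structures
  set 𝔮 := hU'.primeIdealOf ⟨z, hzU'⟩ with h𝔮def
  set 𝔭 := hU.primeIdealOf ⟨π z, hxU⟩ with h𝔭def
  let φ : Γ(X, U) ⟶ Γ(X', π ⁻¹ᵁ U) := π.appLE U (π ⁻¹ᵁ U) le_rfl
  let ιk : CommRingCat.of k ⟶ Γ(Spec (CommRingCat.of k), ⊤) :=
    (Scheme.ΓSpecIso (CommRingCat.of k)).inv
  let ιL : CommRingCat.of L ⟶ Γ(Spec (CommRingCat.of L), ⊤) :=
    (Scheme.ΓSpecIso (CommRingCat.of L)).inv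
  let fk : CommRingCat.of k ⟶ Γ(X, U) := ιk ≫ p.appLE ⊤ U le_top
  let gL : CommRingCat.of L ⟶ Γ(X', π ⁻¹ᵁ U) := ιL ≫ p'.appLE ⊤ (π ⁻¹ᵁ U) le_top
  letI : Algebra k L := σ.toAlgebra
  letI : Algebra Γ(X, U) Γ(X', π ⁻¹ᵁ U) := φ.hom.toAlgebra
  letI : Algebra k Γ(X, U) := fk.hom.toAlgebra
  letI : Algebra L Γ(X', π ⁻¹ᵁ U) := gL.hom.toAlgebra
  letI : Algebra k Γ(X', π ⁻¹ᵁ U) := (φ.hom.comp fk.hom).toAlgebra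
  haveI : IsScalarTower k Γ(X, U) Γ(X', π ⁻¹ᵁ U) := IsScalarTower.of_algebraMap_eq fun _ ↦ rfl
  -- `appLE ⊤ ⊤` is `appTop`, and `appLE` only depends on the morphism
  have happTop : ∀ {Y Z : Scheme.{u}} (g : Y ⟶ Z), g.appLE ⊤ ⊤ le_top = g.appTop := by
    intro Y Z g
    rw [Scheme.Hom.appTop, Scheme.Hom.app_eq_appLE]
    rfl
  have happ : ∀ {g₁ g₂ : X' ⟶ Spec (CommRingCat.of k)} (_ : g₁ = g₂)
      (h₁ : π ⁻¹ᵁ U ≤ g₁ ⁻¹ᵁ ⊤) (h₂ : π ⁻¹ᵁ U ≤ g₂ ⁻¹ᵁ ⊤),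
      g₁.appLE ⊤ (π ⁻¹ᵁ U) h₁ = g₂.appLE ⊤ (π ⁻¹ᵁ U) h₂ := by
    rintro g₁ _ rfl _ _
    rfl
  -- the square `k → Γ(X, U)`, `k → L`, `Γ(X, U) → Γ(X', U')`, `L → Γ(X', U')` commutes ...
  have hsq : fk ≫ φ = CommRingCat.ofHom σ ≫ gL := by
    have h1 : fk ≫ φ = ιk ≫ (π ≫ p).appLE ⊤ (π ⁻¹ᵁ U) le_top := by
      simp only [fk, φ, Category.assoc, Scheme.Hom.appLE_comp_appLE]
    have h2 : CommRingCat.ofHom σ ≫ gL = ιk ≫ (p' ≫ Spec.map (CommRingCat.ofHom σ)).appLE ⊤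
        (π ⁻¹ᵁ U) le_top := by
      simp only [gL, ιL, ιk, ← Category.assoc]
      rw [Scheme.ΓSpecIso_inv_naturality, Category.assoc, ← happTop, Scheme.Hom.appLE_comp_appLE]
    rw [h1, h2, happ H.w]
  have hsq' : φ.hom.comp fk.hom = gL.hom.comp σ := by
    have := congrArg CommRingCat.Hom.hom hsq
    simpa only [CommRingCat.hom_comp, CommRingCat.hom_ofHom] using this
  haveI : IsScalarTower k L Γ(X', π ⁻¹ᵁ U) :=
    IsScalarTower.of_algebraMap_eq fun a ↦ congr($hsq' a)
  -- ... and is a pushout (Mathlib: sections of a fibre product over affine opens)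
  haveI : Algebra.IsPushout k Γ(X, U) L Γ(X', π ⁻¹ᵁ U) := by
    have hUY : π ⁻¹ᵁ U = π ⁻¹ᵁ U ⊓ p' ⁻¹ᵁ ⊤ := by simp
    have hiso := isIso_pushoutSection_of_isAffineOpen H (US := ⊤) (UT := ⊤) (UX := U)
      le_top le_top hUY (isAffineOpen_top _) (isAffineOpen_top _) hU
    have hpo := (isIso_pushoutSection_iff H (US := ⊤) (UT := ⊤) (UX := U) le_top le_top hUY).mp
      hiso
    have hpo' : IsPushout fk (CommRingCat.ofHom σ) φ gL := by
      refine hpo.of_iso (Scheme.ΓSpecIso (CommRingCat.of k)) (Iso.refl _)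
        (Scheme.ΓSpecIso (CommRingCat.of L)) (Iso.refl _) ?_ ?_ ?_ ?_
      · simp [fk, ιk]
      · rw [happTop]
        exact Scheme.ΓSpecIso_naturality _
      · simp [φ]
      · simp [gL, ιL]
    exact (CommRingCat.isPushout_iff_isPushout (R := k) (S := L) (R' := Γ(X, U))
      (S' := Γ(X', π ⁻¹ᵁ U))).mp hpo'
  -- `𝔮` is minimal over `𝔭 Γ(X', U')`: the fibre ring `Γ(X', U')_𝔮 ⧸ 𝔭` has finite length
  have hcomap : 𝔭.asIdeal = Ideal.comap φ.hom 𝔮.asIdeal :=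
    congr($(IsAffineOpen.comap_primeIdealOf_appLE U hU (π ⁻¹ᵁ U) hU' le_rfl hzU').1).symm
  have hmin : 𝔮.asIdeal ∈ (𝔭.asIdeal.map φ.hom).minimalPrimes := by
    refine Literature.RingTheory.KrullDimension.mem_minimalPrimes_map_of_length_ne_top φ.hom 𝔭.asIdeal 𝔮.asIdeal hcomap ?_
    -- transport the length along `𝒪_{fibre, z} ≅ 𝒪_{X', z} ⧸ 𝔪ₓ 𝒪_{X', z} ≅ R'_𝔮 ⧸ 𝔪_{R_𝔭} R'_𝔮`
    obtain ⟨e₁⟩ := nonempty_stalkFiber_ringEquiv_asFiber π z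
    obtain ⟨e₂⟩ := nonempty_fiberQuot_ringEquiv_of_arrowIso
      (IsAffineOpen.arrowStalkMapIso π U hU (π ⁻¹ᵁ U) hU' le_rfl hzU')
    have E := (SubschemeCyclesProofs.length_self_eq_of_ringEquiv e₁).trans (SubschemeCyclesProofs.length_self_eq_of_ringEquiv e₂)
    exact fun h ↦ hlen (E.trans h)
  -- conclude with the dimension of the components of `(R ⧸ 𝔭) ⊗ₖ L`
  haveI : (𝔮.asIdeal).IsPrime := 𝔮.isPrime
  haveI : Algebra.FiniteType k Γ(X, U) := by
    have h1 : (p.appLE ⊤ U le_top).hom.FiniteType :=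
      p.finiteType_appLE (isAffineOpen_top _) hU le_top
    have h2 : ιk.hom.FiniteType :=
      RingHom.FiniteType.of_surjective _
        (Scheme.ΓSpecIso (CommRingCat.of k)).symm.commRingCatIsoToRingEquiv.surjective
    exact h1.comp h2
  have hunder : 𝔮.asIdeal.under Γ(X, U) = 𝔭.asIdeal := hcomap.symm
  have key := Literature.RingTheory.KrullDimension.ringKrullDim_quotient_eq_of_isPushout_of_mem_minimalPrimes (k := k) (L := L)
    (R := Γ(X, U)) 𝔮.asIdeal (by rw [hunder]; exact hmin)
  rw [hunder] at key
  have : ((height z : ℕ∞) : WithBot ℕ∞) = ((height (π z) : ℕ∞) : WithBot ℕ∞) := by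
    rw [hz, hxh, key]
  exact_mod_cast this

end HeightBaseChange

/-! ### Discharge of `AlgebraicCycle.baseChange_mem_cyclesOfDim` -/

section BaseChangeCycles

variable {k L : Type u} [Field k] [Field L] (σ : k →+* L) (X : SchemeOver k)

/-- **Fulton, Intersection Theory, Example 6.2.9** ("the `k`-cycle `α_L = ∑ n_V [V_L]` on `X_L`";
Görtz–Wedhorn I, Prop. 5.38 / Exercise 5.12). Discharge of the named fact
`Literature.AlgebraicGeometry.Motives.AlgebraicCycle.baseChange_mem_cyclesOfDim`: for `X` locally of finite type over `k` and a
field homomorphism `σ : k →+* L`, base change of cycles `π^* : Z_* X → Z_* X_σ` along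
`π : X_σ ⟶ X` maps `Z_d X` into `Z_d X_σ`. Pointwise: if
`(π^* c)(z) = c(π z) · ℓ(𝒪_{(X_σ)_{π z}, z}) ≠ 0` then `c (π z) ≠ 0`, so `height (π z) = d`, and
`z` is generic in its fibre, so `height z = height (π z)`
(`Scheme.height_eq_height_of_length_stalkFiber_ne_top`). Note on the locator: the fact is
vendored in `SubschemeCycles` citing "Fulton Ex. 6.1.2"; the printed statement is Fulton's
Example 6.2.9 ("The operations of intersection theory are compatible with field extension …",
checked in the 1984 first edition, where 6.1.2 is the definition and example on distinguished
varieties). [cite: Fulton1998, Example 6.2.9] [cite: GortzWedhorn2020, Exercise 5.12] -/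
theorem AlgebraicCycle.baseChange_mem_cyclesOfDim_holds :
    AlgebraicCycle.baseChange_mem_cyclesOfDim σ X := by
  intro _ hπ d c hc
  rw [mem_cyclesOfDim_iff] at hc ⊢
  intro z hz
  rw [AlgebraicCycle.baseChange_apply] at hz
  simp only [Scheme.Hom.flatPullbackFun, fundamentalCycleFun_apply, ne_eq, mul_eq_zero,
    not_or, Int.natCast_eq_zero] at hz
  obtain ⟨hc0, hlen0⟩ := hz
  rw [Scheme.height_eq_height_of_length_stalkFiber_ne_top σ X.hom (baseChangeHomFst σ X)
    ((baseChangeHom σ).obj X).hom (IsPullback.of_hasPullback _ _) z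
    (length_ne_top_of_stalkLength_ne_zero hlen0)]
  exact hc _ hc0

end BaseChangeCycles

end Literature.AlgebraicGeometry.Motives
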